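import Literature.Analysis.Complex.OsgoodSeparate
import HarnessLib

/-!
# Osgood's lemma with local boundedness in place of continuity (two-block form)

Analysis/Complex support file (everything proved; theorems only, no definitions, no named facts).
W. F. Osgood's lemma in its ORIGINAL form (Math. Ann. 52 (1899) 462–464; Hörmander, *An Introduction
to Complex Analysis in Several Variables*, §2.2; Gunning–Rossi, Thm. I.A.2): a function
`g : ℂ × P → F` (`P` a finite-dimensional complex normed space, `F` a complex Banach space) on an
open set `U` which is holomorphic in the first variable on every slice `{t | (t, p) ∈ U}`,
holomorphic in the block `P` on every slice `{p | (t, p) ∈ U}`, and LOCALLY BOUNDED on `U`, is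
continuous on `U` (`continuousOn_prod_of_separately_of_locallyBounded`) — hence, by the tree's
continuous form of the lemma (`Literature.Analysis.Complex.SCV.differentiableOn_prod_of_separately`,
file `OsgoodSeparate`), complex (Fréchet-)differentiable on `U`
(`differentiableOn_prod_of_separately_of_locallyBounded`).  The bounded form is the one met in
practice (activities of cluster expansions come with their majorants, not with a continuity
statement); without any boundedness the statement is Hartogs' theorem, not treated here.

## Proof

Continuity at `(t₀, p₀)`: on a bidisc `ball t₀ ε × ball p₀ ε ⊆ U` where `‖g‖ ≤ M`, Cauchy's
estimate for the `t`-slices (`Literature.Analysis.Complex.norm_fderiv_le_of_forall_mem_ball_norm_le`,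
`‖∂_t g(t, p)‖ ≤ 2M/(ε/2)` for `|t − t₀| < ε/2`) and the mean value inequality
(`Convex.norm_image_sub_le_of_norm_fderiv_le`) make the slices `t ↦ g(t, p)` Lipschitz with ONE
constant `4M/ε` for all `p ∈ ball p₀ ε`; the `p`-slice at `t₀` is holomorphic, hence continuous, at
`p₀`; an `ε/2`-argument concludes.

## References

* W. F. Osgood, *Note über analytische Functionen mehrerer Veränderlichen*, Math. Ann. 52 (1899)
  462–464 (the lemma is stated there for bounded functions).
* L. Hörmander, *An Introduction to Complex Analysis in Several Variables* (1973), §2.2.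
  [HormanderSCV1973]

## Mathlib / tree

Mathlib has no statement about separately holomorphic functions (searched `separately`, `Osgood`,
`Hartogs`); tree: `OsgoodSeparate` (continuous form), `HolomorphicParametricIntegral`
(`norm_fderiv_le_of_forall_mem_ball_norm_le`).
-/

noncomputable section

open Metric Set Filter
open _root_.Topology

namespace Literature.Analysis.Complex.SCV

variable {P : Type*} [NormedAddCommGroup P] [NormedSpace ℂ P]
variable {F : Type*} [NormedAddCommGroup F] [NormedSpace ℂ F]

/-- **Separately holomorphic and locally bounded ⟹ continuous** (two-block form; no dimension or
completeness hypothesis): `g : ℂ × P → F` holomorphic in `t` on every slice `{t | (t, p) ∈ U}`,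
holomorphic in `p` on every slice `{p | (t, p) ∈ U}` of the open set `U`, and bounded near every
point of `U`, is continuous on `U`. [cite: HormanderSCV1973, §2.2 (Osgood's lemma)] -/
theorem continuousOn_prod_of_separately_of_locallyBounded {g : ℂ × P → F} {U : Set (ℂ × P)}
    (hU : IsOpen U) (ht : ∀ p : P, DifferentiableOn ℂ (fun t => g (t, p)) {t | (t, p) ∈ U})
    (hp : ∀ t : ℂ, DifferentiableOn ℂ (fun p => g (t, p)) {p | (t, p) ∈ U})
    (hb : ∀ q ∈ U, ∃ M ε : ℝ, 0 < ε ∧ ∀ x ∈ ball q ε, ‖g x‖ ≤ M) :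
    ContinuousOn g U := by
  rintro ⟨t₀, p₀⟩ hq₀
  obtain ⟨M, ε₁, hε₁, hM₁⟩ := hb _ hq₀
  obtain ⟨ε₂, hε₂, hε₂U⟩ := Metric.isOpen_iff.1 hU _ hq₀
  set ε : ℝ := min ε₁ ε₂ with hεdef
  have hε : 0 < ε := lt_min hε₁ hε₂
  -- the bidisc `ball t₀ ε × ball p₀ ε` lies in `U` and `‖g‖ ≤ M` on it
  have hbi : ∀ t ∈ ball t₀ ε, ∀ p ∈ ball p₀ ε, (t, p) ∈ U ∧ ‖g (t, p)‖ ≤ M := by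
    intro t htb p hpb
    have hd : dist (t, p) (t₀, p₀) < ε := by
      rw [Prod.dist_eq]; exact max_lt htb hpb
    exact ⟨hε₂U (lt_of_lt_of_le hd (min_le_right _ _)), hM₁ _ (lt_of_lt_of_le hd (min_le_left _ _))⟩
  have hM0 : 0 ≤ M := (norm_nonneg _).trans (hbi t₀ (mem_ball_self hε) p₀ (mem_ball_self hε)).2
  set L : ℝ := 2 * M / (ε / 2) with hL
  have hL0 : 0 ≤ L := by positivity
  -- the `t`-slices are `L`-Lipschitz on `ball t₀ (ε/2)`, uniformly in `p ∈ ball p₀ ε`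
  have hsmall : ∀ x ∈ ball t₀ (ε / 2), ball x (ε / 2) ⊆ ball t₀ ε := fun x hx y hy => by
    rw [mem_ball] at hx hy ⊢
    calc dist y t₀ ≤ dist y x + dist x t₀ := dist_triangle _ _ _
      _ < ε / 2 + ε / 2 := add_lt_add hy hx
      _ = ε := by ring
  have hLip : ∀ p ∈ ball p₀ ε, ∀ t ∈ ball t₀ (ε / 2), ‖g (t, p) - g (t₀, p)‖ ≤ L * ‖t - t₀‖ := by
    intro p hpb t htb
    have hslice : DifferentiableOn ℂ (fun t => g (t, p)) (ball t₀ ε) :=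
      (ht p).mono fun t' ht' => (hbi t' ht' p hpb).1
    have hdiff : ∀ x ∈ ball t₀ (ε / 2), DifferentiableAt ℂ (fun t => g (t, p)) x := fun x hx =>
      hslice.differentiableAt (isOpen_ball.mem_nhds (hsmall x hx (mem_ball_self (half_pos hε))))
    have hbound : ∀ x ∈ ball t₀ (ε / 2), ‖fderiv ℂ (fun t => g (t, p)) x‖ ≤ L := fun x hx =>
      norm_fderiv_le_of_forall_mem_ball_norm_le (half_pos hε) (hslice.mono (hsmall x hx))
        fun w hw => (hbi w (hsmall x hx hw) p hpb).2
    exact (convex_ball t₀ (ε / 2)).norm_image_sub_le_of_norm_fderiv_le hdiff hbound (mem_ball_self (half_pos hε)) htb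
  -- the `p`-slice at `t₀` is continuous at `p₀`
  have hopen : IsOpen {p : P | (t₀, p) ∈ U} := hU.preimage (by fun_prop)
  have hcv : ContinuousAt (fun p => g (t₀, p)) p₀ := (hp t₀).continuousOn.continuousAt (hopen.mem_nhds hq₀)
  -- assemble an `e∕2 + e∕2` estimate
  rw [ContinuousWithinAt, Metric.tendsto_nhdsWithin_nhds]
  intro e he
  obtain ⟨δ₁, hδ₁, hδ₁'⟩ := Metric.continuousAt_iff.1 hcv (e / 2) (half_pos he)
  refine ⟨min (ε / 2) (min δ₁ ((e / 2) / (L + 1))), by positivity, ?_⟩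
  rintro ⟨t, p⟩ _ hdist
  have htp : dist t t₀ ≤ dist (t, p) (t₀, p₀) ∧ dist p p₀ ≤ dist (t, p) (t₀, p₀) := by
    rw [Prod.dist_eq]; exact ⟨le_max_left _ _, le_max_right _ _⟩
  have h1 : t ∈ ball t₀ (ε / 2) := lt_of_le_of_lt htp.1 (lt_of_lt_of_le hdist (min_le_left _ _))
  have h1' : p ∈ ball p₀ ε :=
    lt_of_le_of_lt htp.2 (lt_of_lt_of_le hdist ((min_le_left _ _).trans (half_le_self hε.le)))
  have h2 : dist p p₀ < δ₁ := lt_of_le_of_lt htp.2 (lt_of_lt_of_le hdist ((min_le_right _ _).trans (min_le_left _ _)))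
  have h3 : ‖t - t₀‖ ≤ (e / 2) / (L + 1) := by
    rw [← dist_eq_norm]; exact htp.1.trans (hdist.le.trans ((min_le_right _ _).trans (min_le_right _ _)))
  have hA : ‖g (t, p) - g (t₀, p)‖ ≤ e / 2 * (L / (L + 1)) :=
    calc ‖g (t, p) - g (t₀, p)‖ ≤ L * ‖t - t₀‖ := hLip p h1' t h1
      _ ≤ L * ((e / 2) / (L + 1)) := mul_le_mul_of_nonneg_left h3 hL0
      _ = e / 2 * (L / (L + 1)) := by ring
  have hfrac : L / (L + 1) < 1 := (div_lt_one (by positivity)).2 (lt_add_one L)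
  have hB : dist (g (t₀, p)) (g (t₀, p₀)) < e / 2 := hδ₁' h2
  calc dist (g (t, p)) (g (t₀, p₀)) ≤ dist (g (t, p)) (g (t₀, p)) + dist (g (t₀, p)) (g (t₀, p₀)) := dist_triangle _ _ _
    _ < e / 2 + e / 2 := by
        refine add_lt_add_of_le_of_lt ?_ hB
        rw [dist_eq_norm]
        exact hA.trans (by nlinarith [he])
    _ = e := by ring

variable [FiniteDimensional ℂ P] [CompleteSpace F]

/-- **Osgood's lemma, two-block form, with local boundedness in place of continuity**: `g : ℂ × P → F`
holomorphic in `t` on every slice, holomorphic in the finite-dimensional block `P` on every slice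
of the open set `U`, and locally bounded on `U`, is complex differentiable on `U` (the previous
theorem + `differentiableOn_prod_of_separately`). [cite: HormanderSCV1973, §2.2 (Osgood's lemma)] -/
theorem differentiableOn_prod_of_separately_of_locallyBounded {g : ℂ × P → F} {U : Set (ℂ × P)}
    (hU : IsOpen U) (ht : ∀ p : P, DifferentiableOn ℂ (fun t => g (t, p)) {t | (t, p) ∈ U})
    (hp : ∀ t : ℂ, DifferentiableOn ℂ (fun p => g (t, p)) {p | (t, p) ∈ U})
    (hb : ∀ q ∈ U, ∃ M ε : ℝ, 0 < ε ∧ ∀ x ∈ ball q ε, ‖g x‖ ≤ M) :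
    DifferentiableOn ℂ g U :=
  differentiableOn_prod_of_separately hU (continuousOn_prod_of_separately_of_locallyBounded hU ht hp hb)
    (fun q hq => (ht q.2).differentiableAt ((hU.preimage (by fun_prop)).mem_nhds (show q.1 ∈ {t | (t, q.2) ∈ U} from hq)))
    hp

/-- **The product case** `U = D × B` (`D ⊆ ℂ` and `B ⊆ P` open) with a GLOBAL bound: separately
holomorphic + bounded ⟹ complex differentiable on `D × B`. [cite: HormanderSCV1973, §2.2 (Osgood's lemma)] -/
theorem differentiableOn_prod_of_separately_of_bound {g : ℂ × P → F} {D : Set ℂ} {B : Set P}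
    (hD : IsOpen D) (hB : IsOpen B) {M : ℝ}
    (ht : ∀ p ∈ B, DifferentiableOn ℂ (fun t => g (t, p)) D)
    (hp : ∀ t ∈ D, DifferentiableOn ℂ (fun p => g (t, p)) B)
    (hM : ∀ x ∈ D ×ˢ B, ‖g x‖ ≤ M) :
    DifferentiableOn ℂ g (D ×ˢ B) := by
  refine differentiableOn_prod_of_separately_of_locallyBounded (hD.prod hB) (fun p => ?_) (fun t => ?_) (fun q hq => ?_)
  · by_cases hpB : p ∈ B
    · exact (ht p hpB).mono fun t ht' => (Set.mem_prod.1 ht').1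
    · exact fun t ht' => absurd (Set.mem_prod.1 ht').2 hpB
  · by_cases htD : t ∈ D
    · exact (hp t htD).mono fun p hp' => (Set.mem_prod.1 hp').2
    · exact fun p hp' => absurd (Set.mem_prod.1 hp').1 htD
  · obtain ⟨ε, hε, hεU⟩ := Metric.isOpen_iff.1 (hD.prod hB) q hq
    exact ⟨M, ε, hε, fun x hx => hM x (hεU hx)⟩

end Literature.Analysis.Complex.SCV

end
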